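import Mathlib

/-!
# Reduction modulo an inert prime for QUARTIC units: `rank U(θ) = |𝒜|` over `𝔽_{p⁴}` certifies a quartic unit class (LEMMA R_p, quartic case)

Helper file for crux `stmt-CriticalPhenomena-4575` (`NoHeavyLowerTail`, route `PercNearOneGluingNoHeavy`), new-inequality factory
seat `prim-ineq-gen-3` (gen 29).  Everything here is PROVED; no definitions.  Quartic companion of `…OrderedDifferencesQuadraticReduction` /
`…CubicReduction`: the relation is `t⁴ = u t³ + v t² + w t + r`, elements of `ℤ[t]` are `a + b t + e t² + g t³`.

* `quartic_mul_expand` — `(a + bt + et² + gt³)(z + t y) = (a z + r g y) + (b z + a y + w g y) t + (e z + b y + v g y) t² + (g z + e y + u g y) t³`.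
* `exists_reduced_dependency_of_integral_dependency_quartic` — ★ an integral dependency `A ↦ a_A + b_A t + e_A t² + g_A t³` of the pencil at `t`
  (in a field `K` where `1, t, t², t³` are `ℤ`-independent) yields a non-zero dependency at `θ` (in a field `F` where `a + bθ + eθ² + gθ³ = 0`
  forces `p ∣ a, b, e, g`) [four integer identities per column; `p`-adic descent on `∑ |a| + |b| + |e| + |g|`; reduction].
* `quartic_mul_t`, `exists_int4_of_mem_adjoin_quartic` — `ℤ[t] = ℤ + ℤ t + ℤ t² + ℤ t³`.
* `linearIndependent_pencil_quartic_of_reduction` — ★★ LEMMA R_p, quartic case (targets: `ζ₅`, `ζ₁₀`, the `k5` quartic `t⁴+2t³−2t²−3t+1`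
  over `𝔽₁₆`; the side hypotheses are discharged in `…OrderedDifferencesQuarticCertificates`).
(prim-ineq-gen-3 gen 29, 2026-08-26.)
-/

namespace Summit.CriticalPhenomena.PercolationContinuityZ3.Theorems

namespace OrderedDifferences

open Finset
open scoped FinsetFamily

variable {α : Type*} [DecidableEq α]

/-- `(a + bt + et² + gt³)(z + t y) = (a z + r g y) + (b z + a y + w g y) t + (e z + b y + v g y) t² + (g z + e y + u g y) t³`
when `t⁴ = u t³ + v t² + w t + r`. -/
theorem quartic_mul_expand {R : Type*} [CommRing R] {t u v w r : R} (ht : t * t * t * t = u * t * t * t + v * t * t + w * t + r)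
    (a b e g z y : R) :
    (a + b * t + e * t * t + g * t * t * t) * (z + t * y) =
      (a * z + r * (g * y)) + (b * z + a * y + w * (g * y)) * t + (e * z + b * y + v * (g * y)) * t * t +
        (g * z + e * y + u * (g * y)) * t * t * t := by
  linear_combination (g * y) * ht

/-- **Integral dependency at `t` ⟹ dependency at the reduction `θ` (quartic).** -/
theorem exists_reduced_dependency_of_integral_dependency_quartic (𝒜 : Finset (Finset α)) (u v w r : ℤ) {p : ℕ} (hp : 1 < p)
    {K : Type*} [Field K] {t : K} (ht : t * t * t * t = (u : K) * t * t * t + (v : K) * t * t + (w : K) * t + (r : K))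
    (hK : ∀ a b e g : ℤ, (a : K) + (b : K) * t + (e : K) * t * t + (g : K) * t * t * t = 0 → a = 0 ∧ b = 0 ∧ e = 0 ∧ g = 0)
    {F : Type*} [Field F] {θ : F} (hθ : θ * θ * θ * θ = (u : F) * θ * θ * θ + (v : F) * θ * θ + (w : F) * θ + (r : F))
    (hF : ∀ a b e g : ℤ, (a : F) + (b : F) * θ + (e : F) * θ * θ + (g : F) * θ * θ * θ = 0 →
      (p : ℤ) ∣ a ∧ (p : ℤ) ∣ b ∧ (p : ℤ) ∣ e ∧ (p : ℤ) ∣ g)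
    (a b e g : ↥𝒜 → ℤ) (habe : ∃ A, a A ≠ 0 ∨ b A ≠ 0 ∨ e A ≠ 0 ∨ g A ≠ 0)
    (hdep : ∀ E ∈ 𝒜 \\ 𝒜, ∑ A : 𝒜, ((a A : K) + (b A : K) * t + (e A : K) * t * t + (g A : K) * t * t * t) *
        ((if E ⊆ (A : Finset α) then (1 : K) else 0) + t * (if Disjoint E (A : Finset α) then (1 : K) else 0)) = 0) :
    ∃ c : ↥𝒜 → F, c ≠ 0 ∧ ∀ E ∈ 𝒜 \\ 𝒜, ∑ A : 𝒜, c A *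
        ((if E ⊆ (A : Finset α) then (1 : F) else 0) + θ * (if Disjoint E (A : Finset α) then (1 : F) else 0)) = 0 := by
  classical
  let zI : ↥𝒜 → Finset α → ℤ := fun A E => if E ⊆ (A : Finset α) then 1 else 0
  let yI : ↥𝒜 → Finset α → ℤ := fun A E => if Disjoint E (A : Finset α) then 1 else 0
  -- the four integer identities per column
  let P0 : (↥𝒜 → ℤ) → (↥𝒜 → ℤ) → (↥𝒜 → ℤ) → (↥𝒜 → ℤ) → Finset α → ℤ :=
    fun a b e g E => ∑ A : 𝒜, (a A * zI A E + r * (g A * yI A E))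
  let P1 : (↥𝒜 → ℤ) → (↥𝒜 → ℤ) → (↥𝒜 → ℤ) → (↥𝒜 → ℤ) → Finset α → ℤ :=
    fun a b e g E => ∑ A : 𝒜, (b A * zI A E + a A * yI A E + w * (g A * yI A E))
  let P2 : (↥𝒜 → ℤ) → (↥𝒜 → ℤ) → (↥𝒜 → ℤ) → (↥𝒜 → ℤ) → Finset α → ℤ :=
    fun a b e g E => ∑ A : 𝒜, (e A * zI A E + b A * yI A E + v * (g A * yI A E))
  let P3 : (↥𝒜 → ℤ) → (↥𝒜 → ℤ) → (↥𝒜 → ℤ) → (↥𝒜 → ℤ) → Finset α → ℤ :=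
    fun a b e g E => ∑ A : 𝒜, (g A * zI A E + e A * yI A E + u * (g A * yI A E))
  have hP : ∀ E ∈ 𝒜 \\ 𝒜, P0 a b e g E = 0 ∧ P1 a b e g E = 0 ∧ P2 a b e g E = 0 ∧ P3 a b e g E = 0 := by
    intro E hE
    have h := hdep E hE
    have ex : ∑ A : 𝒜, ((a A : K) + (b A : K) * t + (e A : K) * t * t + (g A : K) * t * t * t) *
        ((if E ⊆ (A : Finset α) then (1 : K) else 0) + t * (if Disjoint E (A : Finset α) then (1 : K) else 0)) =
        ((P0 a b e g E : ℤ) : K) + ((P1 a b e g E : ℤ) : K) * t + ((P2 a b e g E : ℤ) : K) * t * t +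
          ((P3 a b e g E : ℤ) : K) * t * t * t := by
      push_cast [P0, P1, P2, P3, zI, yI]
      rw [sum_mul, sum_mul, sum_mul, sum_mul, sum_mul, sum_mul, ← sum_add_distrib, ← sum_add_distrib, ← sum_add_distrib]
      refine sum_congr rfl fun A _ => ?_
      rw [quartic_mul_expand ht]
    rw [ex] at h
    exact hK _ _ _ _ h
  -- descent on the integer data
  suffices H : ∀ (n : ℕ) (a b e g : ↥𝒜 → ℤ), ∑ A : 𝒜, ((a A).natAbs + (b A).natAbs + (e A).natAbs + (g A).natAbs) ≤ n →
      (∃ A, a A ≠ 0 ∨ b A ≠ 0 ∨ e A ≠ 0 ∨ g A ≠ 0) →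
      (∀ E ∈ 𝒜 \\ 𝒜, P0 a b e g E = 0 ∧ P1 a b e g E = 0 ∧ P2 a b e g E = 0 ∧ P3 a b e g E = 0) →
      ∃ c : ↥𝒜 → F, c ≠ 0 ∧ ∀ E ∈ 𝒜 \\ 𝒜, ∑ A : 𝒜, c A *
        ((if E ⊆ (A : Finset α) then (1 : F) else 0) + θ * (if Disjoint E (A : Finset α) then (1 : F) else 0)) = 0 from
    H _ a b e g le_rfl habe hP
  intro n
  induction n with
  | zero =>
    intro a b e g hle habe _
    obtain ⟨A, hA⟩ := habe
    have h0 : (a A).natAbs + (b A).natAbs + (e A).natAbs + (g A).natAbs ≤ 0 :=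
      le_trans (single_le_sum (f := fun A : ↥𝒜 => (a A).natAbs + (b A).natAbs + (e A).natAbs + (g A).natAbs)
        (fun _ _ => Nat.zero_le _) (mem_univ A)) hle
    omega
  | succ n ih =>
    intro a b e g hle habe hz
    by_cases hndvd : ∃ A, ¬ ((p : ℤ) ∣ a A) ∨ ¬ ((p : ℤ) ∣ b A) ∨ ¬ ((p : ℤ) ∣ e A) ∨ ¬ ((p : ℤ) ∣ g A)
    · -- reduce modulo p
      obtain ⟨A0, hA0⟩ := hndvd
      refine ⟨fun A => (a A : F) + (b A : F) * θ + (e A : F) * θ * θ + (g A : F) * θ * θ * θ, ?_, ?_⟩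
      · intro hc
        have h0 := congr_fun hc A0
        simp only [Pi.zero_apply] at h0
        obtain ⟨h1, h2, h3, h4⟩ := hF _ _ _ _ h0
        rcases hA0 with h | h | h | h
        · exact h h1
        · exact h h2
        · exact h h3
        · exact h h4
      · intro E hE
        obtain ⟨h1, h2, h3, h4⟩ := hz E hE
        have ex : ∑ A : 𝒜, ((a A : F) + (b A : F) * θ + (e A : F) * θ * θ + (g A : F) * θ * θ * θ) *
            ((if E ⊆ (A : Finset α) then (1 : F) else 0) + θ * (if Disjoint E (A : Finset α) then (1 : F) else 0)) =
            ((P0 a b e g E : ℤ) : F) + ((P1 a b e g E : ℤ) : F) * θ + ((P2 a b e g E : ℤ) : F) * θ * θ +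
              ((P3 a b e g E : ℤ) : F) * θ * θ * θ := by
          push_cast [P0, P1, P2, P3, zI, yI]
          rw [sum_mul, sum_mul, sum_mul, sum_mul, sum_mul, sum_mul, ← sum_add_distrib, ← sum_add_distrib, ← sum_add_distrib]
          refine sum_congr rfl fun A _ => ?_
          rw [quartic_mul_expand hθ]
        rw [ex, h1, h2, h3, h4]
        push_cast
        ring
    · -- all coordinates divisible by p: divide and recurse
      push Not at hndvd
      have hp0 : (p : ℤ) ≠ 0 := by exact_mod_cast (by omega : p ≠ 0)
      let a' : ↥𝒜 → ℤ := fun A => a A / p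
      let b' : ↥𝒜 → ℤ := fun A => b A / p
      let e' : ↥𝒜 → ℤ := fun A => e A / p
      let g' : ↥𝒜 → ℤ := fun A => g A / p
      have ha' : ∀ A, a A = p * a' A := fun A => (Int.mul_ediv_cancel' (hndvd A).1).symm
      have hb' : ∀ A, b A = p * b' A := fun A => (Int.mul_ediv_cancel' (hndvd A).2.1).symm
      have he' : ∀ A, e A = p * e' A := fun A => (Int.mul_ediv_cancel' (hndvd A).2.2.1).symm
      have hg' : ∀ A, g A = p * g' A := fun A => (Int.mul_ediv_cancel' (hndvd A).2.2.2).symm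
      obtain ⟨A0, hA0⟩ := habe
      have hA0' : a' A0 ≠ 0 ∨ b' A0 ≠ 0 ∨ e' A0 ≠ 0 ∨ g' A0 ≠ 0 := by
        rcases hA0 with h | h | h | h
        · left; intro h'; apply h; rw [ha' A0, h']; ring
        · right; left; intro h'; apply h; rw [hb' A0, h']; ring
        · right; right; left; intro h'; apply h; rw [he' A0, h']; ring
        · right; right; right; intro h'; apply h; rw [hg' A0, h']; ring
      have habe' : ∃ A, a' A ≠ 0 ∨ b' A ≠ 0 ∨ e' A ≠ 0 ∨ g' A ≠ 0 := ⟨A0, hA0'⟩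
      have hnat : ∀ x : ℤ, (p * x).natAbs = p * x.natAbs := fun x => by
        rw [Int.natAbs_mul]; simp
      have hle' : ∑ A : 𝒜, ((a' A).natAbs + (b' A).natAbs + (e' A).natAbs + (g' A).natAbs) ≤ n := by
        have hlt : ∑ A : 𝒜, ((a' A).natAbs + (b' A).natAbs + (e' A).natAbs + (g' A).natAbs) <
            ∑ A : 𝒜, ((a A).natAbs + (b A).natAbs + (e A).natAbs + (g A).natAbs) := by
          apply sum_lt_sum
          · intro A _
            rw [ha' A, hb' A, he' A, hg' A, hnat, hnat, hnat, hnat]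
            nlinarith [Nat.zero_le (a' A).natAbs, Nat.zero_le (b' A).natAbs, Nat.zero_le (e' A).natAbs,
              Nat.zero_le (g' A).natAbs]
          · refine ⟨A0, mem_univ _, ?_⟩
            rw [ha' A0, hb' A0, he' A0, hg' A0, hnat, hnat, hnat, hnat]
            have hsum : 0 < (a' A0).natAbs + (b' A0).natAbs + (e' A0).natAbs + (g' A0).natAbs := by
              rcases hA0' with h | h | h | h
              · have := Int.natAbs_pos.mpr h; omega
              · have := Int.natAbs_pos.mpr h; omega
              · have := Int.natAbs_pos.mpr h; omega
              · have := Int.natAbs_pos.mpr h; omega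
            nlinarith
        omega
      have hz' : ∀ E ∈ 𝒜 \\ 𝒜, P0 a' b' e' g' E = 0 ∧ P1 a' b' e' g' E = 0 ∧ P2 a' b' e' g' E = 0 ∧ P3 a' b' e' g' E = 0 := by
        intro E hE
        obtain ⟨h1, h2, h3, h4⟩ := hz E hE
        have e1 : P0 a b e g E = p * P0 a' b' e' g' E := by
          simp only [P0]; rw [mul_sum]; refine sum_congr rfl fun A _ => ?_; rw [ha' A, hg' A]; ring
        have e2 : P1 a b e g E = p * P1 a' b' e' g' E := by
          simp only [P1]; rw [mul_sum]; refine sum_congr rfl fun A _ => ?_; rw [ha' A, hb' A, hg' A]; ring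
        have e3 : P2 a b e g E = p * P2 a' b' e' g' E := by
          simp only [P2]; rw [mul_sum]; refine sum_congr rfl fun A _ => ?_; rw [hb' A, he' A, hg' A]; ring
        have e4 : P3 a b e g E = p * P3 a' b' e' g' E := by
          simp only [P3]; rw [mul_sum]; refine sum_congr rfl fun A _ => ?_; rw [he' A, hg' A]; ring
        rw [e1] at h1; rw [e2] at h2; rw [e3] at h3; rw [e4] at h4
        exact ⟨(mul_eq_zero.mp h1).resolve_left hp0, (mul_eq_zero.mp h2).resolve_left hp0,
          (mul_eq_zero.mp h3).resolve_left hp0, (mul_eq_zero.mp h4).resolve_left hp0⟩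
      exact ih a' b' e' g' hle' habe' hz'

/-- Multiplication by `t` on `ℤ + ℤt + ℤt² + ℤt³` when `t⁴ = u t³ + v t² + w t + r`:
`t (a + bt + et² + gt³) = r g + (a + w g) t + (b + v g) t² + (e + u g) t³`. -/
theorem quartic_mul_t {R : Type*} [CommRing R] {t u v w r : R} (ht : t * t * t * t = u * t * t * t + v * t * t + w * t + r)
    (a b e g : R) :
    t * (a + b * t + e * t * t + g * t * t * t) = r * g + (a + w * g) * t + (b + v * g) * t * t + (e + u * g) * t * t * t := by
  linear_combination g * ht

/-- Every element of `ℤ[t] = Algebra.adjoin ℤ {t}` is `a + b t + e t² + g t³` when `t⁴ = u t³ + v t² + w t + r` (`u v w r : ℤ`). -/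
theorem exists_int4_of_mem_adjoin_quartic {K : Type*} [Field K] {t : K} (u v w r : ℤ)
    (ht : t * t * t * t = (u : K) * t * t * t + (v : K) * t * t + (w : K) * t + (r : K))
    {x : K} (hx : x ∈ Algebra.adjoin ℤ ({t} : Set K)) :
    ∃ a b e g : ℤ, x = (a : K) + (b : K) * t + (e : K) * t * t + (g : K) * t * t * t := by
  -- closure of the normal forms under multiplication by `t`
  have mulT : ∀ a b e g : ℤ, ∃ a' b' e' g' : ℤ,
      t * ((a : K) + (b : K) * t + (e : K) * t * t + (g : K) * t * t * t) =
        (a' : K) + (b' : K) * t + (e' : K) * t * t + (g' : K) * t * t * t := by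
    intro a b e g
    refine ⟨r * g, a + w * g, b + v * g, e + u * g, ?_⟩
    push_cast
    exact quartic_mul_t ht _ _ _ _
  refine Algebra.adjoin_induction (p := fun x _ => ∃ a b e g : ℤ, x = (a : K) + (b : K) * t + (e : K) * t * t +
    (g : K) * t * t * t) ?_ ?_ ?_ ?_ hx
  · intro x hx
    rw [Set.mem_singleton_iff] at hx
    subst hx
    exact ⟨0, 1, 0, 0, by push_cast; ring⟩
  · intro n
    exact ⟨n, 0, 0, 0, by simp⟩
  · rintro x y - - ⟨a, b, e, g, rfl⟩ ⟨a', b', e', g', rfl⟩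
    exact ⟨a + a', b + b', e + e', g + g', by push_cast; ring⟩
  · rintro x y - - ⟨a, b, e, g, rfl⟩ ⟨a', b', e', g', rfl⟩
    -- x * y = a' x + b' (t x) + e' (t (t x)) + g' (t (t (t x)))
    obtain ⟨a1, b1, e1, g1, h1⟩ := mulT a b e g
    obtain ⟨a2, b2, e2, g2, h2⟩ := mulT a1 b1 e1 g1
    obtain ⟨a3, b3, e3, g3, h3⟩ := mulT a2 b2 e2 g2
    refine ⟨a' * a + b' * a1 + e' * a2 + g' * a3, a' * b + b' * b1 + e' * b2 + g' * b3,
      a' * e + b' * e1 + e' * e2 + g' * e3, a' * g + b' * g1 + e' * g2 + g' * g3, ?_⟩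
    have ex : ((a : K) + (b : K) * t + (e : K) * t * t + (g : K) * t * t * t) *
        ((a' : K) + (b' : K) * t + (e' : K) * t * t + (g' : K) * t * t * t) =
        (a' : K) * ((a : K) + (b : K) * t + (e : K) * t * t + (g : K) * t * t * t) +
        (b' : K) * (t * ((a : K) + (b : K) * t + (e : K) * t * t + (g : K) * t * t * t)) +
        (e' : K) * (t * (t * ((a : K) + (b : K) * t + (e : K) * t * t + (g : K) * t * t * t))) +
        (g' : K) * (t * (t * (t * ((a : K) + (b : K) * t + (e : K) * t * t + (g : K) * t * t * t)))) := by ring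
    rw [ex, h1, h2, h3]
    push_cast
    ring

/-- **LEMMA R_p for quartic units.**  Let `t⁴ = u t³ + v t² + w t + r` in a field `K` in which `1, t, t², t³` are independent over `ℤ`,
and `θ⁴ = u θ³ + v θ² + w θ + r` in a field `F` in which `a + bθ + eθ² + gθ³ = 0` (`a b e g : ℤ`) forces `p ∣ a, b, e, g` (`p ≥ 2`).
If the pencil rows of `𝒜` at `θ` are linearly independent over `F`, then the pencil rows of `𝒜` at `t` are linearly independent
over `K`. -/
theorem linearIndependent_pencil_quartic_of_reduction (𝒜 : Finset (Finset α)) (u v w r : ℤ) {p : ℕ} (hp : 1 < p)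
    {F : Type*} [Field F] {θ : F} (hθ : θ * θ * θ * θ = (u : F) * θ * θ * θ + (v : F) * θ * θ + (w : F) * θ + (r : F))
    (hFp : ∀ a b e g : ℤ, (a : F) + (b : F) * θ + (e : F) * θ * θ + (g : F) * θ * θ * θ = 0 →
      (p : ℤ) ∣ a ∧ (p : ℤ) ∣ b ∧ (p : ℤ) ∣ e ∧ (p : ℤ) ∣ g)
    (hF : LinearIndependent F (fun A : 𝒜 => fun E : (𝒜 \\ 𝒜 : Finset (Finset α)) =>
      (if (E : Finset α) ⊆ (A : Finset α) then (1 : F) else 0) +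
        θ * (if Disjoint (E : Finset α) (A : Finset α) then (1 : F) else 0)))
    {K : Type*} [Field K] {t : K} (ht : t * t * t * t = (u : K) * t * t * t + (v : K) * t * t + (w : K) * t + (r : K))
    (hK : ∀ a b e g : ℤ, (a : K) + (b : K) * t + (e : K) * t * t + (g : K) * t * t * t = 0 → a = 0 ∧ b = 0 ∧ e = 0 ∧ g = 0) :
    LinearIndependent K (fun A : 𝒜 => fun E : (𝒜 \\ 𝒜 : Finset (Finset α)) =>
      (if (E : Finset α) ⊆ (A : Finset α) then (1 : K) else 0) +
        t * (if Disjoint (E : Finset α) (A : Finset α) then (1 : K) else 0)) := by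
  classical
  set R : Subalgebra ℤ K := Algebra.adjoin ℤ ({t} : Set K) with hR
  have htR : t ∈ R := Algebra.subset_adjoin (Set.mem_singleton t)
  let vR : ↥𝒜 → (𝒜 \\ 𝒜 : Finset (Finset α)) → R := fun A E =>
    ⟨(if (E : Finset α) ⊆ (A : Finset α) then (1 : K) else 0) +
        t * (if Disjoint (E : Finset α) (A : Finset α) then (1 : K) else 0),
      R.add_mem (by split_ifs <;> simp [R.one_mem, R.zero_mem]) (R.mul_mem htR (by split_ifs <;> simp [R.one_mem, R.zero_mem]))⟩
  have hv : (fun A : ↥𝒜 => algebraMap R K ∘ vR A) = (fun A : 𝒜 => fun E : (𝒜 \\ 𝒜 : Finset (Finset α)) =>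
      (if (E : Finset α) ⊆ (A : Finset α) then (1 : K) else 0) +
        t * (if Disjoint (E : Finset α) (A : Finset α) then (1 : K) else 0)) := by
    funext A E
    rfl
  rw [← hv, linearIndependent_algebraMap_comp_iff]
  by_contra hdepR
  obtain ⟨c, hc, A0, hA0⟩ := Fintype.not_linearIndependent_iff.mp hdepR
  have hcoef : ∀ A : ↥𝒜, ∃ q : ℤ × ℤ × ℤ × ℤ,
      ((c A : R) : K) = (q.1 : K) + (q.2.1 : K) * t + (q.2.2.1 : K) * t * t + (q.2.2.2 : K) * t * t * t := by
    intro A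
    obtain ⟨a, b, e, g, h⟩ := exists_int4_of_mem_adjoin_quartic u v w r ht (c A).2
    exact ⟨(a, b, e, g), h⟩
  choose q hq using hcoef
  have hne : ∃ A, (q A).1 ≠ 0 ∨ (q A).2.1 ≠ 0 ∨ (q A).2.2.1 ≠ 0 ∨ (q A).2.2.2 ≠ 0 := by
    refine ⟨A0, ?_⟩
    by_contra h
    push Not at h
    apply hA0
    have ex : ((c A0 : R) : K) = 0 := by rw [hq A0, h.1, h.2.1, h.2.2.1, h.2.2.2]; simp
    exact Subtype.ext ex
  have hdep : ∀ E ∈ 𝒜 \\ 𝒜, ∑ A : 𝒜, (((q A).1 : K) + ((q A).2.1 : K) * t + ((q A).2.2.1 : K) * t * t +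
      ((q A).2.2.2 : K) * t * t * t) *
      ((if E ⊆ (A : Finset α) then (1 : K) else 0) + t * (if Disjoint E (A : Finset α) then (1 : K) else 0)) = 0 := by
    intro E hE
    have h := congr_fun hc ⟨E, hE⟩
    simp only [Finset.sum_apply, Pi.smul_apply, smul_eq_mul, Pi.zero_apply] at h
    have h' : (((∑ i : ↥𝒜, c i * vR i ⟨E, hE⟩ : R)) : K) = 0 := by rw [h]; rfl
    have ex : ∑ A : 𝒜, (((q A).1 : K) + ((q A).2.1 : K) * t + ((q A).2.2.1 : K) * t * t + ((q A).2.2.2 : K) * t * t * t) *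
        ((if E ⊆ (A : Finset α) then (1 : K) else 0) + t * (if Disjoint E (A : Finset α) then (1 : K) else 0)) =
        (((∑ i : ↥𝒜, c i * vR i ⟨E, hE⟩ : R)) : K) := by
      push_cast
      refine sum_congr rfl fun A _ => ?_
      rw [hq A]
    rw [ex, h']
  obtain ⟨d, hd0, hd⟩ := exists_reduced_dependency_of_integral_dependency_quartic 𝒜 u v w r hp ht hK hθ hFp
    (fun A => (q A).1) (fun A => (q A).2.1) (fun A => (q A).2.2.1) (fun A => (q A).2.2.2) hne hdep
  rw [Fintype.linearIndependent_iff] at hF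
  apply hd0
  funext A
  refine hF d ?_ A
  funext E
  simp only [Finset.sum_apply, Pi.smul_apply, smul_eq_mul, Pi.zero_apply]
  exact hd E E.2

end OrderedDifferences

end Summit.CriticalPhenomena.PercolationContinuityZ3.Theorems
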